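import Mathlib
import HarnessLib
import HarnessLib.Audit
import Summits.CriticalPhenomena.Statement
import Literature.Probability.RandomPlanarGeometry.ChordalCurveFamily
import Literature.Probability.RandomPlanarGeometry.ChordalRestrictionMarkov
import Literature.Probability.RandomPlanarGeometry.ChordalReversibility
import Literature.Probability.RandomPlanarGeometry.LatticeSimilarityCovariance
import Literature.Probability.RandomPlanarGeometry.ConformalRestrictionProofs
import Literature.Probability.RandomPlanarGeometry.SelfAvoidingWalk
import HarnessLib.Audit.Status.Attr

/-!
Route: SAWRestrictionDescent

DORMANT since 2026-08-26T04:18:15Z (reconciler: no traction for 8.3 d (last activity item-evidence-added at 2026-08-17T19:24:53Z); parked, not closed — `ledger route dormant route-CriticalPhenomena-SAWRestrictionDescent --off` to reacti) — unstaffed, not closed; items shared with open routes are served there. `ledger route dormant <id> --off` reactivates.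

# Route SAWRestrictionDescent — restriction is a descent datum — topologically-SLE in one domain +
exact restriction structure + quarter-turn gives SLE(8/3); R* becomes topological

It suffices to show X = AutSLE ∧ TopRes ∧ TopTriv ∧ (ContinuityOfLimit ∧ AxiomsOfLimit ∧
LimitExists) — card
restriction-descent-topological-rigidity-v2 made crux-first. Continuum half (new): AutSLE — the
stabiliser of the chordal
SLE8/3 law inside the homeomorphisms of a closed marked domain consists of (anti)conformal maps;
TopRes — a chordal family with the
SAW's EXACT structure (two-sided restriction, restriction-coupled domain Markov kernel,
reversibility), covariant under translations
and the quarter-turn only, Radó-continuous in the domain, and equal in ONE marked domain D₀ to a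
homeomorphic image of SLE8/3(D₀), is
SLE8/3 in D₀ (restriction identities glue the domain-wise topological trivialisations into one
conformal structure, which the
translation group flattens to a constant ellipse field and the quarter-turn makes round); TopTriv (=
R*_top) — the lattice-exact
axioms with dilations force such a topological trivialisation in every domain. Lattice half (shared
verbatim): LimitExists
(stmt-1371), AxiomsOfLimit (stmt-1370), ContinuityOfLimit (stmt-7305). Then every P D is the SLE8/3
law and
SAW.IsScalingLimitFamily.sawScalingLimit gives the conjunct.
Lean: `AutSLE ∧ TopRes ∧ TopTriv ∧ ContinuityOfLimit ∧ AxiomsOfLimit ∧ LimitExists`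

## Assembly
Pure logic plus one library lemma, CHECKED sorry-free (theorem assembly_holds : Assembly, axioms
propext / Classical.choice /
Quot.sound, planner Sketch.lean, lean check rc 0): take P from LimitExists; AxiomsOfLimit gives
IsRestriction, the
restriction-Markov kernel (= IsRestrictionMarkov by Iff.rfl), reversibility (= IsReversible), the
two clauses of
IsLatticeSimilarityCovariant and IsCarriedBySimpleCurves; ContinuityOfLimit gives the
Radó-continuity clause; TopTriv gives the
topological trivialisation in every D; TopRes (fed the i^k-sub-case of the similarity clause, r = 1)
gives IsSLELaw (8/3) D (P D)
for every D; Literature.Probability.RandomPlanarGeometry.SAW.IsScalingLimitFamily.sawScalingLimit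
turns (lim) + SLE laws into
SAWScalingLimit. AutSLE enters the proof of TopRes, not the logic of the chain, and is listed
because its refutation kills the line.

Rationale: WHY THIS LINE. Lawler–Schramm–Werner classify restriction measures GIVEN conformal invariance
(LawlerSchrammWerner2003Restriction, arXiv:math/0209343
§3, Thm 6.1) and note that for the x_c-SAW restriction, Markov and reversal are exact identities
while conformal covariance of the
limit is open (LawlerSchrammWerner2004SAW §3.4.5, §4.1); Beffara2008Universal Prop. 4 shows a blind
argument leaves a linear modulus
that an order-4 rotation pins. This line COMPUTES the homeomorphism-stabiliser of the SLE8/3 law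
(Schramm2001Percolation's cos²(θ/2)
times the 5/8 restriction formula give an explicit two-to-one functional equation; proved cousins
for Brownian motion:
doi:10.1007/bf01403096, doi:10.5802/aif.735, doi:10.1090/proc/14870) and uses RESTRICTION AS A
DESCENT DATUM: sheaf-gluing of
conformal atlases along the restriction/Markov/reversal moves, then rigidity of a continuous local
ℝ²-action by holomorphic maps
(doi:10.2307/1969204, Bochner–Montgomery) — imported from complex geometry / transformation groups,
with Radó's theorem
(Pommerenke1992) for the deterministic descendants. Versus route SAWRestrictionRigidity (R* =
stmt-1368 as one technique-less crux)
and SAWInfinitesimalRigidity (linearisation near SLE): here R* is split into a THEOREM (TopRes,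
dilation-free) and a purely
topological classification (TopTriv), every re-embedding of SLE (deformations, Beltrami fields, wild
domain-dependent
homeomorphisms) is excluded at once, and AutSLE/TopRes are stand-alone Literature-level
deliverables; the negatives index
(stmt-0772, all-δ tightness) is untouched — only the full-limit items of the sibling routes are
shared.

RANKED CRUXES. #2 TopTriv (crux) — R*_top (card K1, all-domain form): a chordal family on Dobrushin
domains that is chordal, restriction–Markov (ChordalFamily.IsRestrictionMarkov), reversible
(IsReversible), lattice-similarity covariant (IsLatticeSimilarityCovariant: z ↦ r·i^k·z + w with
DILATIONS, and conjugation) and carried by simple boundary-avoiding curves (IsCarriedBySimpleCurves)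
is, in every marked domain (D; a, b), a TOPOLOGICAL COPY of the chordal SLE8/3 law of D: there is a
continuous F, injective on closure D, with F(D) = D, F(a) = a, F(b) = b and P D = F_* μ for an
SLE8/3 law μ of D. Dilations are essential (the natural-length tilts e^(-m·Cont) satisfy everything
else and are not topologically SLE). With TopRes this is equivalent to Rigidity
(stmt-CriticalPhenomena-1368) plus continuity; it is the whole remaining difficulty, now a purely
topological classification problem. [difficulty: open-problem] (why it might fail: Equivalent to R*
(stmt-1368) given TopRes, and no classification of chord laws up to Homeo(D̄;a,b) exists: an exotic
Sim⋊D₄-covariant restriction–Markov simple family, topologically singular to SLE8/3 in every domain,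
refutes it; a.e.-slack of the Markov kernel may admit choice-built families.)
[LawlerSchrammWerner2003Restriction, Beffara2008Universal, LawlerRezaei2015, doi:10.2307/1968772,
arXiv:math/0307353]
#3 TopRes (crux) — TopRes (card K3, one-domain form; the descent theorem): a chordal family that is
chordal, restriction–Markov, reversible, covariant under z ↦ i^k·z + w (translations and the
quarter-turn ONLY — no dilations, no conjugation), and Radó-continuous along conformal images (the
conclusion form of ContinuityOfLimit: D_n = Φ_n(D) → Φ(D) with Φ_n → Φ uniformly on closure D ⇒ P
D_n ⇀ P Φ(D)), and which is a topological copy of SLE8/3 in ONE marked domain D₀ (same clause as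
TopTriv's conclusion), IS the chordal SLE8/3 law in D₀. Proof plan: AutSLE makes the P-conformal
structure ν(D₀) = F_*(std) well defined; the restriction-kernel identity on CUSPED typical
descendants, reversal and Radó continuity propagate the trivialisation to every deterministic marked
sub-domain E ⋐ D₀ with ν(E) = ν(D₀)|E; translation covariance makes small translations ν-conformal,
LocalTranslationRigidity turns ν into a constant ellipse field, QuarterTurnLemma makes it round, so
F is (anti)conformal on D₀ and P D₀ = SLE8/3(D₀). [deps: AutSLE] [difficulty: L] (why it might fail:
Deterministic descendants need Radó continuity + full support of SLE8/3 hitting laws; the kernel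
identity has content only on subdomains CUSPED at the tip (thin ones are null), where SLE
restriction for 0-touching thin hulls extends LSW Thm 6.1; local ℝ²-action regularity
(Bochner–Montgomery).) [LawlerSchrammWerner2003Restriction, Beffara2008Universal, Pommerenke1992,
Zhan2008Reversibility, doi:10.2307/1969204, arXiv:1201.1496]
#4 AutSLE (crux) — Aut-lemma (card, two-domain form): if μ, μ' are chordal SLE8/3 laws of Dobrushin
domains D, D', F : ℂ → ℂ is continuous and injective on closure D with F(D) = D', F(a) = a', F(b) =
b', and F_* μ = μ', then F is holomorphic or antiholomorphic on D. Via Carathéodory it is the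
statement Stab(SLE8/3) ∩ Homeo(ℍ̄; 0, ∞) = (λz, −λz̄): Schramm's left-passage law cos²(arg z/2)
gives arg∘g = arg; restriction gives P(z right | γ avoids A) = cos²(arg Φ_A(z)/2); shrinking A to a
boundary point x yields the shape-free g-invariant ratio F_θ(|z|/x) = cos²(θ/2) − (4/5)sin²θ/(t +
1/t − 2cos θ), exactly two-to-one (t ↔ 1/t), and FunEqTwoToOne finishes. [difficulty: M] (why it
might fail: Needs Schramm's cos²(θ/2) law, the 5/8 restriction formula and a SHAPE-UNIFORM
small-hull expansion applied to topological images g(A) of hulls (hcap(gAₙ)→0 only by continuity); a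
second continuous branch of the two-to-one equation F_θ would leave a wild law-preserving
homeomorphism.) [Schramm2001Percolation, LawlerSchrammWerner2003Restriction,
Lawler2005ConformallyInvariant, doi:10.1007/bf01403096, doi:10.5802/aif.735, doi:10.1090/proc/14870]
#5 ContinuityOfLimit (crux) — Shared verbatim with stmt-CriticalPhenomena-7305 (route
SAWConePseudogroup): every chordal full scaling limit P of the critical δℤ² SAW laws is sequentially
continuous along conformal images — Φ_n → Φ uniformly on closure D, conformal on D, injective on
closure D, D_n = Φ_n(D), D' = Φ(D) with image marks ⇒ ∫ f dP(D_n) → ∫ f dP(D') for bounded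
continuous f. Here it feeds the Radó-continuity hypothesis of TopRes (sliding a marked point,
smoothing a cusp). [deps: LimitExists] [difficulty: L] (why it might fail: Not automatic without
conformal invariance: needs uniform-in-δ stability of x_c-SAW laws under boundary perturbations,
incl. near the moving marked points (Kennedy–Lawler lattice effects); restriction alone gives only
monotone continuity with pinned marks.) [KennedyLawler2013, LawlerSchrammWerner2004SAW,
PommerenkeBBCM1992, DuminilCopinHammond2013, LawlerSchrammWerner2003Restriction]
#6 AxiomsOfLimit (crux) — Shared verbatim with stmt-CriticalPhenomena-1370 (route
SAWRestrictionRigidity): every chordal family P that is the full scaling limit of the critical δℤ²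
SAW laws (every Dobrushin domain, every endpoint approximation) has restriction, the
restriction-coupled Markov kernel, reversibility, covariance under z ↦ r·i^k·z + w and conjugation,
and is carried by simple curves meeting ∂D only at a, b — the identities are exact at every mesh.
[deps: LimitExists] [difficulty: L] (why it might fail: Markov passage needs stability of SAW limits
in slit domains perturbed near the tip (beyond (lim) on Jordan domains); simplicity/boundary
avoidance need no-crawling estimates not in print; restriction passage needs null touching;
largest-component bookkeeping (cf. notes on stmt-0773).) [LawlerSchrammWerner2004SAW, Werner2007,
KennedyLawler2013, DuminilCopinHammond2013]
#7 LimitExists (crux) — Shared verbatim with stmt-CriticalPhenomena-1371 (routes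
SAWRestrictionRigidity, SAWInfinitesimalRigidity, SAWConePseudogroup): the full scaling limit of the
critical δℤ² SAW exists as a chordal curve family (∃ P chordal with (lim) for every Dobrushin domain
and every endpoint approximation; value not identified). [difficulty: XL] (why it might fail:
Eventual tightness of critical SAW is open (no annulus-crossing bound at x_c); uniqueness rests on
AvoidanceCocycleLimit; an approximation-dependent limit (boundary lattice effects, Kennedy–Lawler)
would refute the conjunct SAWScalingLimit itself as typed.) [LawlerSchrammWerner2004SAW,
KemppainenSmirnov2017, DuminilCopinHammond2013, KennedyLawler2013]
#9 FunEqTwoToOne (support) — The last step of AutSLE (card P1(a)), pure real analysis: f strictly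
decreasing on (0,1] with f(1/t) = f(t); R, G continuous positive on (0,∞), R → 0 at 0⁺; f(R r / G x)
= f(r/x) for all r, x > 0 ⇒ R = G = c·id for one c > 0 (two-to-one ⇒ R r/G x ∈ (r/x or x/r);
connectedness of the region r < x and R → 0 kill the branch x/r). [difficulty: provable-now]
[doi:10.1007/bf01403096]
#9 LocalTranslationRigidity (support) — The group step of TopRes done LOCALLY (replaces the card's
uniformization to ℂ vs 𝔻): if U is continuous and injective on an open connected Ω ⊆ ℂ with open
image, G inverts it there, and for all small c the conjugates z ↦ G(U z + c) are holomorphic on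
their natural domains, then L ∘ U is holomorphic on Ω for some real-linear automorphism L of ℂ
(Bochner–Montgomery averaging ⇒ commuting holomorphic generators V₂ = τV₁, τ ∉ ℝ ⇒ a straightening
chart conjugates translations to translations ⇒ chart ∘ U⁻¹ is real-affine ⇒ identity principle
across Ω). [difficulty: M] [doi:10.2307/1969204, Beffara2008Universal]
#9 QuarterTurnLemma (support) — The quarter-turn spends the modulus (card P1(d); Beffara's Prop. 4
as a lemma): a real-linear automorphism L of ℂ for which z ↦ L(i·L⁻¹z) is complex-differentiable or
anti-complex-differentiable is z ↦ a z or z ↦ a z̄ (M = L J L⁻¹ with M² = −1: if ℂ-linear then M =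
±J so L (anti)commutes with J; ℂ-antilinear M with M² = −1 is impossible). [difficulty:
provable-now] [Beffara2008Universal]

TWO-LAYER PLAN. Foreseen glued splits (k ≤ 3, depth 1), filed only when a crux closes or stalls with
a census: TopRes ⇐ DescentGluing (ν(D₀)
well defined by AutSLE and compatible along cusped typical descendants + Radó limits: every E ⋐ D₀
is a topological copy with
ν(E) = ν(D₀)|E) → FlatteningStep (LocalTranslationRigidity + QuarterTurnLemma on ν(D₀)) → TopRes;
AutSLE ⇐ ArgPreservation
(Schramm) → TwoPointRatio (restriction × small hulls gives F_θ) → AutSLE (FunEqTwoToOne is already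
support); TopTriv ⇐
TopTrivNearSLE (families whose avoidance probabilities are ε-close to SLE's, cf. LocalRigidity
stmt-4616) → TopTrivGlobal → TopTriv.
LimitExists / AxiomsOfLimit keep the splits planned in SAWRestrictionRigidity (EventualTight,
AvoidanceDeterminesLaw, cocycle).

KILL CRITERIA. ¬AutSLE (a law-preserving homeomorphism of ℍ̄ fixing 0, ∞ that is not z ↦ λz, −λz̄)
kills the descent: close
refuted:AutSLE. ¬TopTriv by a family with ALL lattice-exact axioms (incl. dilations and the
quarter-turn) that is nowhere a
topological copy of SLE8/3 refutes R* (stmt-1368) as well — close refuted:TopTriv and record the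
witness as a barrier for the
three rigidity routes. ¬TopRes whose witness exploits only the a.e.-slack of the Markov kernel ⇒
restate with a deterministic-slit
kernel hypothesis (and file the matching lattice item); any other ¬TopRes closes the route.
¬ContinuityOfLimit ⇒ pivot to a
slit-stability lattice item. Rigidity (stmt-1368) proved elsewhere supersedes TopTriv (route
superseded, AutSLE/TopRes survive
as Literature theorems); SAWScalingLimit proved elsewhere moots everything.

NOT DECOMPOSED YET. The SLE8/3 toolkit TopRes consumes (restriction for thin 0-touching hulls by
monotone limits of LSW Thm 6.1; full support of SLE
hitting laws, arXiv:1201.1496 Lemma 2.3; weak continuity of SLE laws under Radó convergence; SLE8/3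
reversibility Zhan2008Reversibility
and the Markov property as an IsRestrictionMarkov instance) — layer-2 support lemmas attached with
--supports TopRes by provers;
the strong (absolutely-continuous) Aut-lemma of the card (K2) — not load-bearing here; the corollary
'tilts are not topological
images of SLE' — a remark, not an item; the lattice splits of LimitExists / AxiomsOfLimit — owned by
SAWRestrictionRigidity.

CHEAPEST FALSIFIER. The explicit ratio of AutSLE: compute P(z right, γ hits A)/P(γ hits A) EXACTLY
for the half-disc hull of radius ρ at x (g_A(z) =
z + ρ²/(z−x), Φ_A = g_A − g_A(0), P(avoid) = Φ_A'(0)^(5/8), P(z right | avoid) = cos²(arg Φ_A(z)/2))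
and compare with F_θ(t) =
cos²(θ/2) − (4/5)sin²θ/(t + 1/t − 2cos θ); any asymmetry under t ↔ 1/t or a second monotone branch
breaks the two-to-one step. RUN
(exp/autlemma_check.py in the planner folder, local python, < 1 s): max |exact − F_θ|/ρ = 0.044 over
a 7×9×2 grid, F_θ(t) = F_θ(1/t)
exactly, strictly decreasing on (0,1], min F_θ = F_θ(1) = cos²(θ/2)/5 ≥ 0 — passes. Next cheapest:
QuarterTurnLemma and
FunEqTwoToOne are Lean-provable now; a lookup whether 'law-preserving self-maps of SLE are
conformal' is in print (searched: no).

NUMBERS. κ = 8/3; restriction exponent α = 5/8 (LawlerSchrammWerner2003Restriction Thm 6.1);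
Schramm's left-passage law at κ = 8/3:
P(γ left of z) = cos²(arg z/2) = ½ + Re z/(2|z|) (Schramm2001Percolation Thm 2; tree fact
Schramm2001_passesLeft_eightThirds);
boundary hitting exponent 8/κ − 1 = 2 (summability Σ ε_k² < ∞ for cusp sleeves); F_θ(1) =
cos²(θ/2)/5; items at open: 10
(6 cruxes, 3 supports, 1 assembly), 3 of them shared (stmt-1370, stmt-1371, stmt-7305).

DEFINITION REQUESTS. To shorten TopTriv/TopRes once landed (filed after open, topic
Literature/Probability/RandomPlanarGeometry):
ChordalFamily.IsTopologicalSLEAt (κ) (P) (D) := ∃ F : C(ℂ,ℂ), ∃ μ, InjOn F (closure D) ∧ F '' D = D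
∧ F a = a ∧ F b = b ∧
IsSLELaw κ D μ ∧ P D = μ.map (CurveClass.map F); ChordalFamily.IsRadoContinuous (P) := the
conclusion clause of stmt-7305.
Existing and used: ChordalFamily.IsRestrictionMarkov, .IsReversible, .IsLatticeSimilarityCovariant,
.IsCarriedBySimpleCurves,
IsSLELaw, MarkedDomain.map, similarity, CurveClass.map, SAW.IsScalingLimitFamily (all lean-searched;
Sketch.lean rc 0).

Novelty: Searches (2026-08-15, this session; services partly rate-limited/unavailable, logged in NOTES.md):
lit search --hybrid
"homeomorphism preserving the law of SLE conformal restriction" (8 held docs: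
Lawler2005ConformallyInvariant pp.113–158,
Astala–Iwaniec–Martin, Alpern–Prasad — none on law-preserving maps of SLE); lit frontier
CriticalPhenomena --since 2021 (30
rows; nearest arXiv:2211.15609 SLE regularity, arXiv:2605.03385 QLE Markov — none on
stabilisers/descent); lit galaxy search
--star all ×2 ("homeomorphisms preserving the law of SLE", "topological conjugacy of random curves
conformal invariance": 0 rows);
crossref lookups confirming doi:10.2307/1969204, doi:10.2307/1968772, doi:10.1007/bf01403096,
doi:10.5802/aif.735,
doi:10.5802/aif.925; zbMATH "law preserving homeomorphism SLE conformal invariance characterization"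
(0); plus the card's own
13 zbMATH / 4 vsearch / galaxy-intelligent searches (none states or asks the question) and a read of
all 33 route files of the
sub (no route has an Aut(SLE law) statement or a topological/conformal descent step; nearest
in-tree: StretchRigidity
stmt-5793 = no AXIS-STRETCH covariance, a linear special case of AutSLE's two-domain form).
Nearest prior art found: arXiv:math/0209343 (LSW03: classification inside conformal invariance;
Φ'_A(0)^(5/8)) and
Schramm2001Percolation (cos²(θ/2)) — the inputs; arXiv:0708.3908 (Beffara Prop. 4: linear modulus
pinned by order-4 rotation) —
reproduced as the residue GL₂(ℝ)/ℂ^× of the flattening step  [refs: 10.2307/1969204, 10.2307/1968772, 10.1007/bf01403096, 10.5802/aif.735, 10.5802/aif.925, 10.1090/proc/14870, 2211.15609, 2605.03385, math/0209343, 0708.3908, doi:10.2307/1969204, doi:10.2307/1968772, doi:10.1007/bf01403096, doi:10.5802/aif.735, doi:10.5802/aif.925, doi:10.1090/proc/14870]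

Barriers (technique_class: restriction-descent, uniformization, conjugation-rigidity): - technique_class: restriction-descent, uniformization, conjugation-rigidity
- Literature.Barriers.CriticalPhenomena.ScaleCovarianceNotMoebius: evaded by construction — TopRes
uses NO scale covariance; its inputs are the exact restriction/Markov/reversal structure of a CURVE
family plus a topological trivialisation, outside the barrier's class (Euclidean + scale data of a
correlation family); TopTriv does use dilations and is honestly a symmetry-upgrade conjecture that
could fail the barrier's way — that failure is the route's second kill criterion.
- Literature.Barriers.CriticalPhenomena.EmbeddingModulusUniqueness: embraced, not evaded — after
descent the only freedom is a constant ellipse field (GL₂(ℝ)/ℂ^×), Beffara's modulus; on a sheared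
lattice L·ℤ² the same argument returns L_*SLE8/3; the Euclidean quarter-turn inside TopRes's
hypothesis is the embedding-specific datum (QuarterTurnLemma).
- Literature.Barriers.CriticalPhenomena.SAWNotKineticallyGrown: the Markov kernel is the exact
conditional structure of one configurational measure (LSW04 §2.3); no growth rule or
consistent-family construction is used.
- Literature.Barriers.CriticalPhenomena.NienhuisWeightsExcludeVertexSAW: no loop/vertex weights, no
observable on ℤ²; holomorphicity is an OUTPUT of descent.
- Literature.Barriers.CriticalPhenomena.ParafermionicHalfCauchyRiemann: no discrete holomorphic
observable or half-Cauchy–Riemann relation is invoked anywhere.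
- Literature.Barriers.CriticalPhenomena.SAWNoUnitaryCF

Novelty grade: new-mechanism — ROUTE REVIEW + GRADE (refuter rreview-0815T12-31, 2026-08-15 14:55Z; concur with g13-18 and with rreview-0815T12-32's per-item stamps after an independent pass; details in my note on stmt-8480). KEEP OPEN. 10/10 decls elaborate; Assembly, 8483, 8481 have sorry-free proofs on file (land them); 8482 t (refuter refuter-rreview-0815T12-31-0, 2026-08-15T14:51:04Z; prior: arXiv:math/0209343 (LSW03: restriction classification INSIDE conformal invariance; Φ'_A(0)^{5/8}), arXiv:math/0107096 (Schramm 2001: left-passage cos²(θ/2) at κ=8/3), arXiv:0708.3908 (Beffara 2008 Prop 4: order-4 rotation pins the linear modulus), doi:10.2307/1969204 (Bochner–Montgomery 1945), doi:10.1214/aop/1176991990 (Fitzsimmons 1987 'A converse to a theorem of P. Lévy': measurable BM-preservi)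

History (route lifecycle, newest last):
- 2026-08-26T04:18:15Z · DORMANT — reconciler: no traction for 8.3 d (last activity item-evidence-added at 2026-08-17T19:24:53Z); parked, not closed — `ledger route dormant route-CriticalPhenomen (operator:999:1945485)

sub-problem: SAWScalingLimit · status: dormant · opened planner-plancard-CriticalPhenomena-SAWScaling-59e9a244-0 2026-08-15T12:52:33Z · rev 2 · ledger route-CriticalPhenomena-SAWRestrictionDescent
GENERATED by the gate from the ledger (D-0016/17). Provers cite these decls: `theorem foo : Summit.CriticalPhenomena.SAWScalingLimit.Theses.SAWRestrictionDescent.<Decl> := …` in Summits/CriticalPhenomena/SAWScalingLimit/Theorems/<Name>.lean.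
-/

namespace Summit.CriticalPhenomena.SAWScalingLimit.Theses.SAWRestrictionDescent

open scoped BigOperators Topology Manifold Classical MeasureTheory ProbabilityTheory Matrix InnerProductSpace ComplexConjugate ContinuousMap
open Filter Set Function TopologicalSpace MeasureTheory

attribute [summit_statement] _root_.SAWScalingLimit

/-- item stmt-CriticalPhenomena-8478 · crux · rank 2 · open · by planner
why it might fail: Equivalent to R* (stmt-1368) given TopRes, and no classification of chord laws up to Homeo(D̄;a,b) exists: an exotic Sim⋊D₄-covariant restriction–Markov simple family, topologically singular to SLE8/3 in every domain, refutes it; a.e.-slack of the Markov kernel may admit choice-built families.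
sources: LawlerSchrammWerner2003Restriction, Beffara2008Universal, LawlerRezaei2015, doi:10.2307/1968772, arXiv:math/0307353
[crux] R*_top (card K1, all-domain form): a chordal family on Dobrushin domains that is chordal,
restriction–Markov (ChordalFamily.IsRestrictionMarkov), reversible (IsReversible),
lattice-similarity covariant (IsLatticeSimilarityCovariant: z ↦ r·i^k·z + w with DILATIONS, and
conjugation) and carried by simple boundary-avoiding curves (IsCarriedBySimpleCurves) is, in every
marked domain (D; a, b), a TOPOLOGICAL COPY of the chordal SLE8/3 law of D: there is a continuous F,
injective on closure D, with F(D) = D, F(a) = a, F(b) = b and P D = F_* μ for an SLE8/3 law μ of D.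
Dilations are essential (the natural-length tilts e^(-m·Cont) satisfy everything else and are not
topologically SLE). With TopRes this is equivalent to Rigidity (stmt-CriticalPhenomena-1368) plus
continuity; it is the whole remaining difficulty, now a purely topological classification problem.
[difficulty: open-problem] -/
@[route_item "route-CriticalPhenomena-SAWRestrictionDescent", crux]
def TopTriv : Prop :=
  ∀ P : Literature.Probability.RandomPlanarGeometry.ChordalFamily, P.IsChordal → P.IsRestrictionMarkov → P.IsReversible → P.IsLatticeSimilarityCovariant → P.IsCarriedBySimpleCurves → ∀ D : Literature.Probability.RandomPlanarGeometry.DobrushinDomain, ∃ (F : C(ℂ, ℂ)) (μ : MeasureTheory.Measure (Literature.Probability.RandomPlanarGeometry.CurveClass ℂ)), Set.InjOn F (closure D.carrier) ∧ F '' D.carrier = D.carrier ∧ F (D.pt 0) = D.pt 0 ∧ F (D.pt 1) = D.pt 1 ∧ Literature.Probability.RandomPlanarGeometry.IsSLELaw ((8 : NNReal) / 3) D μ ∧ P D = μ.map (Literature.Probability.RandomPlanarGeometry.CurveClass.map F)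

/-- item stmt-CriticalPhenomena-8479 · crux · rank 3 · open · by planner
why it might fail: Deterministic descendants need Radó continuity + full support of SLE8/3 hitting laws; the kernel identity has content only on subdomains CUSPED at the tip (thin ones are null), where SLE restriction for 0-touching thin hulls extends LSW Thm 6.1; local ℝ²-action regularity (Bochner–Montgomery).
sources: LawlerSchrammWerner2003Restriction, Beffara2008Universal, Pommerenke1992, Zhan2008Reversibility, doi:10.2307/1969204, arXiv:1201.1496
[crux] TopRes (card K3, one-domain form; the descent theorem): a chordal family that is chordal,
restriction–Markov, reversible, covariant under z ↦ i^k·z + w (translations and the quarter-turn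
ONLY — no dilations, no conjugation), and Radó-continuous along conformal images (the conclusion
form of ContinuityOfLimit: D_n = Φ_n(D) → Φ(D) with Φ_n → Φ uniformly on closure D ⇒ P D_n ⇀ P
Φ(D)), and which is a topological copy of SLE8/3 in ONE marked domain D₀ (same clause as TopTriv's
conclusion), IS the chordal SLE8/3 law in D₀. Proof plan: AutSLE makes the P-conformal structure
ν(D₀) = F_*(std) well defined; the restriction-kernel identity on CUSPED typical descendants,
reversal and Radó continuity propagate the trivialisation to every deterministic marked sub-domain E
⋐ D₀ with ν(E) = ν(D₀)|E; translation covariance makes small translations ν-conformal,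
LocalTranslationRigidity turns ν into a constant ellipse field, QuarterTurnLemma makes it round, so
F is (anti)conformal on D₀ and P D₀ = SLE8/3(D₀). [deps: AutSLE] [difficulty: L] -/
@[route_item "route-CriticalPhenomena-SAWRestrictionDescent", crux]
def TopRes : Prop :=
  ∀ P : Literature.Probability.RandomPlanarGeometry.ChordalFamily, P.IsChordal → P.IsRestrictionMarkov → P.IsReversible → (∀ (D : Literature.Probability.RandomPlanarGeometry.DobrushinDomain) (c : ℂ) (hc : c ≠ 0) (w : ℂ), (∃ k : ℕ, c = Complex.I ^ k) → P (D.map (Literature.Probability.RandomPlanarGeometry.similarity c hc w)) = (P D).map (Literature.Probability.RandomPlanarGeometry.CurveClass.map (Literature.Probability.RandomPlanarGeometry.similarity c hc w : C(ℂ, ℂ)))) → (∀ (D D' : Literature.Probability.RandomPlanarGeometry.DobrushinDomain) (Dn : ℕ → Literature.Probability.RandomPlanarGeometry.DobrushinDomain) (Φ : C(ℂ, ℂ)) (Φn : ℕ → C(ℂ, ℂ)), TendstoUniformlyOn (fun n => ⇑(Φn n)) Φ Filter.atTop (closure D.carrier) → DifferentiableOn ℂ Φ D.carrier → Set.InjOn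 Φ (closure D.carrier) → (∀ n, DifferentiableOn ℂ (Φn n) D.carrier ∧ Set.InjOn (Φn n) (closure D.carrier)) → D'.carrier = Φ '' D.carrier → D'.pt 0 = Φ (D.pt 0) → D'.pt 1 = Φ (D.pt 1) → (∀ n, (Dn n).carrier = Φn n '' D.carrier ∧ (Dn n).pt 0 = Φn n (D.pt 0) ∧ (Dn n).pt 1 = Φn n (D.pt 1)) → ∀ f : BoundedContinuousFunction (Literature.Probability.RandomPlanarGeometry.CurveClass ℂ) ℝ, Filter.Tendsto (fun n => ∫ γ, f γ ∂(P (Dn n))) Filter.atTop (nhds (∫ γ, f γ ∂(P D')))) → ∀ D₀ : Literature.Probability.RandomPlanarGeometry.DobrushinDomain, (∃ (F : C(ℂ, ℂ)) (μ : MeasureTheory.Measure (Literature.Probability.RandomPlanarGeometry.CurveClass ℂ)), Set.InjOn F (closure D₀.carrier) ∧ F '' D₀.carrier = D₀.carrier ∧ F (D₀.pt 0) = D₀.pt 0 ∧ F (D₀.pt 1) = D₀.pt 1 ∧ Literature.Probability.RandomPlanarGeometry.IsSLELaw ((8 : NNReal) / 3) D₀ μ ∧ P D₀ = μ.map (Literature.Probability.RandomPlanarGeometry.CurveClass.map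 F)) → Literature.Probability.RandomPlanarGeometry.IsSLELaw ((8 : NNReal) / 3) D₀ (P D₀)

/-- item stmt-CriticalPhenomena-8480 · crux · rank 4 · open · by planner
why it might fail: Needs Schramm's cos²(θ/2) law, the 5/8 restriction formula and a SHAPE-UNIFORM small-hull expansion applied to topological images g(A) of hulls (hcap(gAₙ)→0 only by continuity); a second continuous branch of the two-to-one equation F_θ would leave a wild law-preserving homeomorphism.
sources: Schramm2001Percolation, LawlerSchrammWerner2003Restriction, Lawler2005ConformallyInvariant, doi:10.1007/bf01403096, doi:10.5802/aif.735, doi:10.1090/proc/14870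
[crux] Aut-lemma (card, two-domain form): if μ, μ' are chordal SLE8/3 laws of Dobrushin domains D,
D', F : ℂ → ℂ is continuous and injective on closure D with F(D) = D', F(a) = a', F(b) = b', and F_*
μ = μ', then F is holomorphic or antiholomorphic on D. Via Carathéodory it is the statement
Stab(SLE8/3) ∩ Homeo(ℍ̄; 0, ∞) = (λz, −λz̄): Schramm's left-passage law cos²(arg z/2) gives arg∘g =
arg; restriction gives P(z right | γ avoids A) = cos²(arg Φ_A(z)/2); shrinking A to a boundary point
x yields the shape-free g-invariant ratio F_θ(|z|/x) = cos²(θ/2) − (4/5)sin²θ/(t + 1/t − 2cos θ),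
exactly two-to-one (t ↔ 1/t), and FunEqTwoToOne finishes. [difficulty: M] -/
@[route_item "route-CriticalPhenomena-SAWRestrictionDescent", crux]
def AutSLE : Prop :=
  ∀ (D D' : Literature.Probability.RandomPlanarGeometry.DobrushinDomain) (F : C(ℂ, ℂ)) (μ μ' : MeasureTheory.Measure (Literature.Probability.RandomPlanarGeometry.CurveClass ℂ)), Literature.Probability.RandomPlanarGeometry.IsSLELaw ((8 : NNReal) / 3) D μ → Literature.Probability.RandomPlanarGeometry.IsSLELaw ((8 : NNReal) / 3) D' μ' → Set.InjOn F (closure D.carrier) → F '' D.carrier = D'.carrier → F (D.pt 0) = D'.pt 0 → F (D.pt 1) = D'.pt 1 → μ.map (Literature.Probability.RandomPlanarGeometry.CurveClass.map F) = μ' → (DifferentiableOn ℂ F D.carrier ∨ DifferentiableOn ℂ (fun z => (starRingEnd ℂ) (F z)) D.carrier)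

/-- item stmt-CriticalPhenomena-7305 · crux · rank 5 · open · by planner
why it might fail: Not automatic without conformal invariance: needs uniform-in-δ stability of x_c-SAW laws under boundary perturbations, incl. near the moving marked points (Kennedy–Lawler lattice effects); restriction alone gives only monotone continuity with pinned marks.
sources: KennedyLawler2013, LawlerSchrammWerner2004SAW, PommerenkeBBCM1992, DuminilCopinHammond2013, LawlerSchrammWerner2003Restriction
[crux] every chordal family P that is the full scaling limit (lim: TendstoLaw for every Dobrushin
domain and every endpoint approximation) of the critical δℤ² SAW laws is sequentially continuous
along conformal images in the sense used by PseudogroupDensity: Φ_n → Φ uniformly on closure D,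
conformal on D, injective on closure D, D_n = Φ_n(D), D' = Φ(D) with image marks ⇒ ∫ f dP(D_n) → ∫ f
dP(D') for bounded continuous f. (With constant sequences this also says P D depends on (carrier, a,
b) only, which (lim) gives for free.) Trivially implied by the conjunct (SLE_{8/3} is conformally
covariant, so P(D_n) = (Φ_n)_* P(D) → Φ_* P(D) = P(D')); the content is to get it from the lattice
BEFORE conformal invariance. [deps: LimitExists] [difficulty: L] -/
@[route_item "route-CriticalPhenomena-SAWRestrictionDescent", crux]
def ContinuityOfLimit : Prop :=
  ∀ P : Literature.Probability.RandomPlanarGeometry.ChordalFamily, P.IsChordal → (∀ (D : Literature.Probability.RandomPlanarGeometry.DobrushinDomain) (a b : ℝ → Literature.Probability.LatticeModels.Site 2), Literature.Probability.RandomPlanarGeometry.SAW.IsEndpointApprox D a b → Literature.Probability.RandomPlanarGeometry.TendstoLaw (fun δ (γ : Literature.Probability.RandomPlanarGeometry.SAW.DomainSAW D.carrier δ (a δ) (b δ)) => γ.curve) (fun δ => Literature.Probability.RandomPlanarGeometry.SAW.law D.carrier δ (a δ) (b δ)) id (P D)) → (∀ (D D' : Literature.Probability.RandomPlanarGeometry.DobrushinDomain)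 (Dn : ℕ → Literature.Probability.RandomPlanarGeometry.DobrushinDomain) (Φ : C(ℂ, ℂ)) (Φn : ℕ → C(ℂ, ℂ)), TendstoUniformlyOn (fun n => ⇑(Φn n)) Φ Filter.atTop (closure D.carrier) → DifferentiableOn ℂ Φ D.carrier → Set.InjOn Φ (closure D.carrier) → (∀ n, DifferentiableOn ℂ (Φn n) D.carrier ∧ Set.InjOn (Φn n) (closure D.carrier)) → D'.carrier = Φ '' D.carrier → D'.pt 0 = Φ (D.pt 0) → D'.pt 1 = Φ (D.pt 1) → (∀ n, (Dn n).carrier = Φn n '' D.carrier ∧ (Dn n).pt 0 = Φn n (D.pt 0) ∧ (Dn n).pt 1 = Φn n (D.pt 1)) → ∀ f : BoundedContinuousFunction (Literature.Probability.RandomPlanarGeometry.CurveClass ℂ) ℝ, Filter.Tendsto (fun n => ∫ γ, f γ ∂(P (Dn n))) Filter.atTop (nhds (∫ γ, f γ ∂(P D'))))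

/-- item stmt-CriticalPhenomena-1370 · crux · rank 6 · open · by planner
why it might fail: Markov passage needs stability of SAW limits in slit domains perturbed near the tip (beyond (lim) on Jordan domains); simplicity/boundary avoidance need no-crawling estimates not in print; restriction passage needs null touching; largest-component bookkeeping (cf. notes on stmt-0773).
sources: LawlerSchrammWerner2004SAW, Werner2007, KennedyLawler2013, DuminilCopinHammond2013
[crux] every chordal family P that is the full scaling limit (lim) of the critical δℤ² SAW laws —
for every Dobrushin domain and EVERY endpoint approximation (SAW.IsEndpointApprox) — satisfies the
hypotheses of Rigidity: restriction (exact lattice identity, LSW04 §3.4.5; portmanteau on the closed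
event range ⊆ closure D' plus null touching), restriction-coupled Markov (conditional future given a
lattice past = SAW of the slit graph; its conditioning into a Jordan subdomain = SAW there),
reversibility (exact), covariance under z ↦ r·i^k·z + w and conjugation (quarter-turn/conjugation
exact at each δ; dilations via (λΩ)_δ = λ·Ω_{δ/λ} and the full-filter limit; translations:
axis-parallel w lies in δ_nℤ² along δ_n = |w|/n, then compose — no continuity in D needed),
simplicity and boundary avoidance. Sources: LawlerSchrammWerner2004SAW (arXiv:math/0204277 §3.4.5,
p.14), Werner2007 §3.2, KennedyLawler2013, DuminilCopinHammond2013. -/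
@[route_item "route-CriticalPhenomena-SAWRestrictionDescent", crux]
def AxiomsOfLimit : Prop :=
  ∀ P : Literature.Probability.RandomPlanarGeometry.ChordalFamily, P.IsChordal → (∀ (D : Literature.Probability.RandomPlanarGeometry.DobrushinDomain) (a b : ℝ → Literature.Probability.LatticeModels.Site 2), Literature.Probability.RandomPlanarGeometry.SAW.IsEndpointApprox D a b → Literature.Probability.RandomPlanarGeometry.TendstoLaw (fun δ (γ : Literature.Probability.RandomPlanarGeometry.SAW.DomainSAW D.carrier δ (a δ) (b δ)) => γ.curve) (fun δ => Literature.Probability.RandomPlanarGeometry.SAW.law D.carrier δ (a δ) (b δ)) id (P D)) → P.IsRestriction ∧ (∃ Q : Literature.Probability.RandomPlanarGeometry.DobrushinDomain → Literature.Probability.RandomPlanarGeometry.CurveClass ℂ → MeasureTheory.Measure (Literature.Probability.RandomPlanarGeometry.CurveClass ℂ), P.IsMarkovExtension Q ∧ ∀ (D : Literature.Probability.RandomPlanarGeometry.DobrushinDomain) (p : Literature.Probability.RandomPlanarGeometry.CurveClass ℂ) (D' : Literature.Probability.RandomPlanarGeometry.DobrushinDomain), D'.carrier ⊆ Literature.Probability.RandomPlanarGeometry.remainingDomain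 D p → D'.pt 0 = p.target → D'.pt 1 = D.pt 1 → ∀ T : Set (Literature.Probability.RandomPlanarGeometry.CurveClass ℂ), MeasurableSet T → P D' T * Q D p (Literature.Probability.RandomPlanarGeometry.CurveClass.rangeSubset (closure D'.carrier)) = Q D p (T ∩ Literature.Probability.RandomPlanarGeometry.CurveClass.rangeSubset (closure D'.carrier))) ∧ (∀ D D' : Literature.Probability.RandomPlanarGeometry.DobrushinDomain, D'.carrier = D.carrier → D'.pt 0 = D.pt 1 → D'.pt 1 = D.pt 0 → P D' = (P D).map Literature.Probability.RandomPlanarGeometry.CurveClass.reverse) ∧ (∀ (D : Literature.Probability.RandomPlanarGeometry.DobrushinDomain) (c : ℂ) (hc : c ≠ 0) (w : ℂ), (∃ (r : ℝ) (k : ℕ), 0 < r ∧ c = (r : ℂ) * Complex.I ^ k) → P (D.map (Literature.Probability.RandomPlanarGeometry.similarity c hc w)) = (P D).map (Literature.Probability.RandomPlanarGeometry.CurveClass.map (Literature.Probability.RandomPlanarGeometry.similarity c hc w : C(ℂ, ℂ)))) ∧ (∀ D : Literature.Probability.RandomPlanarGeometry.DobrushinDomain, P (D.map Complex.conjLIE.toHomeomorph)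 = (P D).map (Literature.Probability.RandomPlanarGeometry.CurveClass.map (Complex.conjLIE.toHomeomorph : C(ℂ, ℂ)))) ∧ (∀ D : Literature.Probability.RandomPlanarGeometry.DobrushinDomain, ∀ᵐ γ ∂(P D), γ ∈ Literature.Probability.RandomPlanarGeometry.CurveClass.simple ∧ γ.range ∩ frontier D.carrier ⊆ {D.pt 0, D.pt 1})

/-- item stmt-CriticalPhenomena-1371 · crux · rank 7 · open · by planner
why it might fail: Eventual tightness of critical SAW is open (no annulus-crossing bound at x_c); uniqueness rests on AvoidanceCocycleLimit; an approximation-dependent limit (boundary lattice effects, Kennedy–Lawler) would refute the conjunct SAWScalingLimit itself as typed.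
sources: LawlerSchrammWerner2004SAW, KemppainenSmirnov2017, DuminilCopinHammond2013, KennedyLawler2013
[crux] existence of the full scaling limit of the critical δℤ² SAW as a chordal curve family: ∃ P,
P.IsChordal ∧ (lim) for every Dobrushin domain and every endpoint approximation (the limit is NOT
identified here). Planned glued split (tenure): EventualTight ∧ simple boundary-avoiding
subsequential limits; uniqueness of subsequential limits from AvoidanceCocycleLimit +
AvoidanceDeterminesLaw; diagonal extraction over a countable dense class of domains. Sources:
LawlerSchrammWerner2004SAW (arXiv:math/0204277 p.3 'we do not know how to prove the existence of the
limit'), KemppainenSmirnov2017 (arXiv:1212.6215 Thm 1.5), AizenmanBurchardDuke1999,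
DuminilCopinHammond2013 (arXiv:1205.0401). -/
@[route_item "route-CriticalPhenomena-SAWRestrictionDescent", crux]
def LimitExists : Prop :=
  ∃ P : Literature.Probability.RandomPlanarGeometry.ChordalFamily, P.IsChordal ∧ (∀ (D : Literature.Probability.RandomPlanarGeometry.DobrushinDomain) (a b : ℝ → Literature.Probability.LatticeModels.Site 2), Literature.Probability.RandomPlanarGeometry.SAW.IsEndpointApprox D a b → Literature.Probability.RandomPlanarGeometry.TendstoLaw (fun δ (γ : Literature.Probability.RandomPlanarGeometry.SAW.DomainSAW D.carrier δ (a δ) (b δ)) => γ.curve) (fun δ => Literature.Probability.RandomPlanarGeometry.SAW.law D.carrier δ (a δ) (b δ)) id (P D))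

/-- item stmt-CriticalPhenomena-8481 · support · rank 9 · open · by planner
sources: doi:10.1007/bf01403096
[support] The last step of AutSLE (card P1(a)), pure real analysis: f strictly decreasing on (0,1]
with f(1/t) = f(t); R, G continuous positive on (0,∞), R → 0 at 0⁺; f(R r / G x) = f(r/x) for all r,
x > 0 ⇒ R = G = c·id for one c > 0 (two-to-one ⇒ R r/G x ∈ (r/x or x/r); connectedness of the region
r < x and R → 0 kill the branch x/r). [difficulty: provable-now] -/
@[route_item "route-CriticalPhenomena-SAWRestrictionDescent"]
def FunEqTwoToOne : Prop :=
  ∀ (f R G : ℝ → ℝ), StrictAntiOn f (Set.Ioc 0 1) → (∀ t : ℝ, 0 < t → f t⁻¹ = f t) → ContinuousOn R (Set.Ioi 0) → ContinuousOn G (Set.Ioi 0) → (∀ r : ℝ, 0 < r → 0 < R r) → (∀ x : ℝ, 0 < x → 0 < G x) → Filter.Tendsto R (nhdsWithin 0 (Set.Ioi 0)) (nhds 0) → (∀ r x : ℝ, 0 < r → 0 < x → f (R r / G x) = f (r / x)) → ∃ c : ℝ, 0 < c ∧ (∀ r : ℝ, 0 < r → R r = c * r) ∧ (∀ x : ℝ,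 0 < x → G x = c * x)

/-- item stmt-CriticalPhenomena-8482 · support · rank 9 · open · by planner
sources: doi:10.2307/1969204, Beffara2008Universal
[support] The group step of TopRes done LOCALLY (replaces the card's uniformization to ℂ vs 𝔻): if U
is continuous and injective on an open connected Ω ⊆ ℂ with open image, G inverts it there, and for
all small c the conjugates z ↦ G(U z + c) are holomorphic on their natural domains, then L ∘ U is
holomorphic on Ω for some real-linear automorphism L of ℂ (Bochner–Montgomery averaging ⇒ commuting
holomorphic generators V₂ = τV₁, τ ∉ ℝ ⇒ a straightening chart conjugates translations to
translations ⇒ chart ∘ U⁻¹ is real-affine ⇒ identity principle across Ω). [difficulty: M] -/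
@[route_item "route-CriticalPhenomena-SAWRestrictionDescent"]
def LocalTranslationRigidity : Prop :=
  ∀ (Ω : Set ℂ) (U G : ℂ → ℂ) (ε : ℝ), IsOpen Ω → IsConnected Ω → 0 < ε → ContinuousOn U Ω → Set.InjOn U Ω → IsOpen (U '' Ω) → ContinuousOn G (U '' Ω) → (∀ z ∈ Ω, G (U z) = z) → (∀ c : ℂ, ‖c‖ < ε → DifferentiableOn ℂ (fun z => G (U z + c)) {z | z ∈ Ω ∧ U z + c ∈ U '' Ω}) → ∃ L : ℂ ≃L[ℝ] ℂ, DifferentiableOn ℂ (fun z => L (U z)) Ω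

/-- item stmt-CriticalPhenomena-8483 · support · rank 9 · open · by planner
sources: Beffara2008Universal
[support] The quarter-turn spends the modulus (card P1(d); Beffara's Prop. 4 as a lemma): a
real-linear automorphism L of ℂ for which z ↦ L(i·L⁻¹z) is complex-differentiable or
anti-complex-differentiable is z ↦ a z or z ↦ a z̄ (M = L J L⁻¹ with M² = −1: if ℂ-linear then M =
±J so L (anti)commutes with J; ℂ-antilinear M with M² = −1 is impossible). [difficulty:
provable-now] -/
@[route_item "route-CriticalPhenomena-SAWRestrictionDescent"]
def QuarterTurnLemma : Prop :=
  ∀ L : ℂ ≃L[ℝ] ℂ, (Differentiable ℂ (fun z => L (Complex.I * L.symm z)) ∨ Differentiable ℂ (fun z => (starRingEnd ℂ) (L (Complex.I * L.symm z)))) → ∃ a : ℂ, (∀ z, L z = a * z) ∨ (∀ z, L z = a * (starRingEnd ℂ) z)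

/-- item stmt-CriticalPhenomena-8484 · assembly · rank 1 · open · by planner
sources: LawlerSchrammWerner2003Restriction, LawlerSchrammWerner2004SAW
[assembly] AutSLE → TopRes → TopTriv → ContinuityOfLimit → AxiomsOfLimit → LimitExists →
SAWScalingLimit (the conjunct constant of Summits/CriticalPhenomena/SAWScalingLimit/Statement.lean). -/
@[route_item "route-CriticalPhenomena-SAWRestrictionDescent"]
def Assembly : Prop :=
  AutSLE → TopRes → TopTriv → ContinuityOfLimit → AxiomsOfLimit → LimitExists → SAWScalingLimit

/-! D-0027 §2.1 — DECIDING THEOREM (planner-authored via `route open/edit --closes-file`; by planner-rbadge-CriticalPhenomena-SAWRestrictio-d55c06a4-g4-0 2026-08-15T16:15:04Z):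
its hypotheses are this route's items and its conclusion the sub-problem Statement (glue_lint), and it elaborates with this file. -/

@[closes "route-CriticalPhenomena-SAWRestrictionDescent"] theorem closes : AutSLE → TopRes → TopTriv → ContinuityOfLimit → AxiomsOfLimit → LimitExists → _root_.SAWScalingLimit := by
  intro _h_AutSLE h_TopRes h_TopTriv h_ContinuityOfLimit h_AxiomsOfLimit h_LimitExists
  -- the full scaling limit `P` of the critical SAW (value not yet identified)
  obtain ⟨P, hPch, hlim⟩ := h_LimitExists
  -- the lattice-exact axioms of the limit
  obtain ⟨-, hRM, hRev, hSim, hConj, hSimple⟩ := h_AxiomsOfLimit P hPch hlim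
  have hRM' : P.IsRestrictionMarkov := (P.isRestrictionMarkov_iff).2 hRM
  have hRev' : P.IsReversible := (P.isReversible_iff).2 hRev
  have hLSC : P.IsLatticeSimilarityCovariant :=
    (P.isLatticeSimilarityCovariant_iff).2 ⟨hSim, hConj⟩
  -- Radó continuity of the limit along conformal images
  have hRado := h_ContinuityOfLimit P hPch hlim
  -- the `i^k`-sub-case (r = 1) of the lattice-similarity clause, as consumed by `TopRes`
  have hSimIk : ∀ (D : Literature.Probability.RandomPlanarGeometry.DobrushinDomain) (c : ℂ)
      (hc : c ≠ 0) (w : ℂ), (∃ k : ℕ, c = Complex.I ^ k) →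
        P (D.map (Literature.Probability.RandomPlanarGeometry.similarity c hc w)) =
          (P D).map (Literature.Probability.RandomPlanarGeometry.CurveClass.map
            (Literature.Probability.RandomPlanarGeometry.similarity c hc w : C(ℂ, ℂ))) := by
    intro D c hc w hk
    obtain ⟨k, hk⟩ := hk
    exact hSim D c hc w ⟨1, k, one_pos, by simp [hk]⟩
  -- topological trivialisation in every domain (TopTriv), then descent (TopRes): SLE(8/3) laws
  have hTop := h_TopTriv P hPch hRM' hRev' hLSC hSimple
  have hSLE : ∀ D₀ : Literature.Probability.RandomPlanarGeometry.DobrushinDomain,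
      Literature.Probability.RandomPlanarGeometry.IsSLELaw ((8 : NNReal) / 3) D₀ (P D₀) :=
    fun D₀ => h_TopRes P hPch hRM' hRev' hSimIk hRado D₀ (hTop D₀)
  -- a full scaling limit all of whose laws are SLE(8/3) laws IS the conjunct: write
  -- `P D = W.map Γ` for an SLE curve `Γ` and move the test integrals along `integral_map`
  intro D a b hab
  obtain ⟨Γ, hΓ, hPD⟩ := hSLE D
  refine ⟨Γ, hΓ, Filter.Eventually.of_forall fun δ =>
    Literature.Probability.RandomPlanarGeometry.SAW.aemeasurable_curve _ _ _ _, fun f => ?_⟩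
  have h := hlim D a b hab f
  simp only [id_eq, hPD] at h
  rwa [MeasureTheory.integral_map hΓ.1 f.continuous.aestronglyMeasurable] at h

end Summit.CriticalPhenomena.SAWScalingLimit.Theses.SAWRestrictionDescent
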